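import Summits.ResolutionOfSingularities.ResolutionOfSingularities.Theorems.PurelyInseparableDim4ApproxCoordChange
import Summits.ResolutionOfSingularities.ResolutionOfSingularities.Theorems.PurelyInseparableDim4IsolationCert
import Summits.ResolutionOfSingularities.ResolutionOfSingularities.Theorems.PurelyInseparableDim4ResConeLevelTwoAbsorption
import HarnessLib
import HarnessLib.Audit.Tags

/-!
# Purely inseparable four-folds — TWO-SLOT GAME, DIVISIBILITY READINGS: a pair ledger in contact form kills every
# low coefficient off the slot product and below `x_f³` (cell `res-dim4-pi`, K2(p) lane, slice B brick K24a, β3b)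

[OURS · counted 0 · cell `res-dim4-pi` · K2(p) lane (holder res-dim4-p-12 g3, «p-1 takes K24a» 2026-08-29
01:14Z; statement layer 01:24Z, part β3); pair presentation `A₀ = x_κx_o S₀, A₁ = x_κx_o S₁` of res-dim4-idea-4 g3
(bus 00:38:54Z) · seat res-dim4-p-1 g3.]  Nothing here proves K2(p)/K2(5), `NoIsolatedTrap p p` or resolution of
singularities in dimension ≥ 4 / characteristic `p`.  AI kernel work, weaker than expert review.

THE READ-OFF.  β3 = «in the canonical jet frame the residual `G̃` is, below `x_f³` and up to high order, divisible by
the slot product `x_A x_B`».  Its INPUT is the PAIR-MERGED LEDGER in contact form — `U·G̃ = S·x_A x_B + T·H̃³` with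
`U(0) ≠ 0` (K11 `stretch_ledger` at the two stretch-born slot letters → K8
`exists_unit_mul_mem_span_X_hasseDeriv_pow_of_mem` to the common Hasse contact `H = D_f^{(2)} G` → K2 merge, as in
K25d for three letters) — together with the JET SHAPE of the contact polynomial in the Tschirnhaus frame,
`H̃ = x_f·W + R`, `R ∈ 𝔪₀^M` (D3 `jet_iff_hasseContact`: in the jet frame `D_f^{(2)} G̃` has no `x_f`-free monomial
of degree `≤ N`).  This file does the algebra that turns these into coefficient vanishings:

* §1 `not_single_add_single_le` (feeding p-3's `coeff_eq_zero_of_mem_span_X_mul_X`, imported),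
  `coeff_eq_zero_of_mem_span_X_pow`, `coeff_eq_zero_of_mem_originIdeal_pow` — supports of multiples.
* §2 `mem_sup_of_unit_mul_mem` — a unit factor is harmless modulo `𝔪₀^M` (over p-7's
  `ApproxCoordChange.le_span_mul_sup_pow`).
* §3 **`coeff_eq_zero_of_pair_ledger`** — `coeff_n G̃ = 0` whenever `|n| < M`, `n_f < 3` and `n_A = 0 ∨ n_B = 0`;
  **`reading_eq_zero_of_pair_ledger`** — the same on `F̃ = x^r·G̃`: `coeff_{r+m} F̃ = 0` (β6's `hdivκ` with
  `m_κ = 0`, and its mirror `m_o = 0`).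

[cite: CossartJannsenSaito2020, Thm. 3.14] bears_on: LADDER-RESOLUTION:D157-DOOR2 (res-dim4-pi · K2(p) · slice B ·
K24a-β3b).  Supports stmt-ResolutionOfSingularities-16155 (helper).
-/

set_option linter.dupNamespace false -- mandated namespace of this single-conjunct summit

noncomputable section

namespace Summit.ResolutionOfSingularities.ResolutionOfSingularities.Theorems.PIDim4

namespace ResCone

open MvPolynomial
open Literature.AlgebraicGeometry.Resolution

variable {K : Type} [Field K]

/-! ## 1. Supports of multiples -/

/-- An exponent vanishing at `A` or at `B` is not above `e_A + e_B` (so p-3's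
`coeff_eq_zero_of_mem_span_X_mul_X` applies: a multiple of `x_A x_B` has no such monomial). [folklore] -/
theorem not_single_add_single_le {A B : Fin 4} {n : Fin 4 →₀ ℕ} (hn : n A = 0 ∨ n B = 0) :
    ¬ Finsupp.single A 1 + Finsupp.single B 1 ≤ n := by
  intro h
  rcases hn with h0 | h0
  · have h1 := h A
    rw [Finsupp.add_apply, Finsupp.single_eq_same, h0] at h1
    omega
  · have h1 := h B
    rw [Finsupp.add_apply, Finsupp.single_eq_same, h0] at h1
    omega

/-- A multiple of `x_f^k` has no monomial of `x_f`-degree `< k`. [folklore] -/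
theorem coeff_eq_zero_of_mem_span_X_pow {f : Fin 4} {k : ℕ} {P : MvPolynomial (Fin 4) K}
    (hP : P ∈ Ideal.span {(X f ^ k : MvPolynomial (Fin 4) K)}) {n : Fin 4 →₀ ℕ} (hn : n f < k) :
    coeff n P = 0 := by
  obtain ⟨q, rfl⟩ := Ideal.mem_span_singleton'.mp hP
  rw [mul_comm, X_pow_eq_monomial, coeff_monomial_mul', if_neg fun h => ?_]
  have := h f
  rw [Finsupp.single_eq_same] at this
  omega

/-- An element of `𝔪₀^M` has no monomial of degree `< M`. [folklore] -/
theorem coeff_eq_zero_of_mem_originIdeal_pow {M : ℕ} {P : MvPolynomial (Fin 4) K} (hP : P ∈ originIdeal K ^ M)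
    {n : Fin 4 →₀ ℕ} (hn : n.degree < M) : coeff n P = 0 :=
  (IsolationCert.mem_originIdeal_pow_iff M P).mp hP n hn

/-! ## 2. Units modulo `𝔪₀^M` -/

/-- **A unit factor is harmless modulo `𝔪₀^M`**: if `U·G ∈ J ⊔ 𝔪₀^M` with `U(0) ≠ 0` then `G ∈ J ⊔ 𝔪₀^M`.
[folklore] -/
theorem mem_sup_of_unit_mul_mem {U G : MvPolynomial (Fin 4) K} (hU : constantCoeff U ≠ 0)
    {J : Ideal (MvPolynomial (Fin 4) K)} {M : ℕ} (h : U * G ∈ J ⊔ originIdeal K ^ M) :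
    G ∈ J ⊔ originIdeal K ^ M := by
  have h1 := ApproxCoordChange.le_span_mul_sup_pow hU (Ideal.span {G}) M (Ideal.mem_span_singleton_self G)
  rw [Ideal.span_singleton_mul_span_singleton] at h1
  have h2 : Ideal.span {U * G} ≤ J ⊔ originIdeal K ^ M := (Ideal.span_singleton_le_iff_mem _).mpr h
  exact sup_le h2 le_sup_right h1

/-! ## 3. The read-off -/

/-- **DIVISIBILITY READINGS FROM A PAIR LEDGER IN CONTACT FORM** (K24a-β3b).  If `U·G = S·(x_A x_B) + T·H³` with
`U(0) ≠ 0` and the contact polynomial has the jet shape `H = x_f·W + R`, `R ∈ 𝔪₀^M`, then every coefficient of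
`G` at an exponent `n` with `|n| < M`, `n_f < 3` and `n_A = 0 ∨ n_B = 0` vanishes — `G ∈ (x_A x_B, x_f³) + 𝔪₀^M`.
[OURS] [cite: CossartJannsenSaito2020, Thm. 3.14] -/
theorem coeff_eq_zero_of_pair_ledger {A B f : Fin 4} {G U S T H W R : MvPolynomial (Fin 4) K} {M : ℕ}
    (hU : constantCoeff U ≠ 0) (hledger : U * G = S * (X A * X B) + T * H ^ 3) (hH : H = X f * W + R)
    (hR : R ∈ originIdeal K ^ M) {n : Fin 4 →₀ ℕ} (hnM : n.degree < M) (hnf : n f < 3)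
    (hn : n A = 0 ∨ n B = 0) : coeff n G = 0 := by
  set J : Ideal (MvPolynomial (Fin 4) K) :=
    Ideal.span {(X A * X B : MvPolynomial (Fin 4) K)} ⊔ Ideal.span {(X f ^ 3 : MvPolynomial (Fin 4) K)} with hJ
  -- `H³ ∈ (x_f³) + 𝔪₀^M`
  have hH3 : H ^ 3 ∈ Ideal.span {(X f ^ 3 : MvPolynomial (Fin 4) K)} ⊔ originIdeal K ^ M := by
    have hexp : H ^ 3 = X f ^ 3 * W ^ 3 + R * (3 * (X f * W) ^ 2 + 3 * (X f * W) * R + R ^ 2) := by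
      rw [hH]; ring
    rw [hexp]
    exact Submodule.add_mem_sup (Ideal.mul_mem_right _ _ (Ideal.mem_span_singleton_self _))
      (Ideal.mul_mem_right _ _ hR)
  -- `U·G ∈ J + 𝔪₀^M`
  have hUG : U * G ∈ J ⊔ originIdeal K ^ M := by
    rw [hledger, hJ, sup_assoc]
    refine Submodule.add_mem_sup (Ideal.mul_mem_left _ _ (Ideal.mem_span_singleton_self _)) ?_
    exact Ideal.mul_mem_left _ _ hH3
  -- hence `G ∈ J + 𝔪₀^M`; read the coefficient
  have hG := mem_sup_of_unit_mul_mem hU hUG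
  obtain ⟨y, hy, z, hz, hyz⟩ := Submodule.mem_sup.mp hG
  obtain ⟨y₁, hy₁, y₂, hy₂, rfl⟩ := Submodule.mem_sup.mp hy
  rw [← hyz, coeff_add, coeff_add, coeff_eq_zero_of_mem_span_X_mul_X hy₁ (not_single_add_single_le hn),
    coeff_eq_zero_of_mem_span_X_pow hy₂ hnf, coeff_eq_zero_of_mem_originIdeal_pow hz hnM, add_zero, add_zero]

/-- **The same, read on `F̃ = x^r·G̃`** (β6's `hdivκ` and its mirror): `coeff_{r+m} F̃ = 0` for `|m| < M`, `m_f < 3`,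
`m_A = 0 ∨ m_B = 0`. [OURS] [cite: CossartJannsenSaito2020, Thm. 3.14] -/
theorem reading_eq_zero_of_pair_ledger {A B f : Fin 4} {F G U S T H W R : MvPolynomial (Fin 4) K}
    {r : Fin 4 →₀ ℕ} {M : ℕ} (hF : F = monomial r 1 * G) (hU : constantCoeff U ≠ 0)
    (hledger : U * G = S * (X A * X B) + T * H ^ 3) (hH : H = X f * W + R) (hR : R ∈ originIdeal K ^ M)
    {m : Fin 4 →₀ ℕ} (hmM : m.degree < M) (hmf : m f < 3) (hm : m A = 0 ∨ m B = 0) :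
    coeff (r + m) F = 0 := by
  rw [hF, coeff_monomial_mul', if_pos le_self_add, add_tsub_cancel_left, one_mul]
  exact coeff_eq_zero_of_pair_ledger hU hledger hH hR hmM hmf hm

end ResCone

end Summit.ResolutionOfSingularities.ResolutionOfSingularities.Theorems.PIDim4

end
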